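import Literature.NumberTheory.LFunctions.DirichletPolynomialGallagher
import Mathlib.Analysis.SpecialFunctions.Pow.Complex
import HarnessLib

/-!
# Twisted Dirichlet polynomials: the discrete mean value with a shift absorbed in the coefficients

Support file for the separated bilinear discrete mean value (`HyperbolicBilinearMeanValue.lean`),
the separation-of-variables step of Conrey–Iwaniec, *Spacing of zeros of Hecke L-functions and the
class number problem*, Acta Arith. 103 (2002), §9 p. 20 (proof of Proposition 9.1; "Lemma 5.3" =
the discrete mean value theorem for Dirichlet polynomials). Everything here is PROVED: for
`1`-spaced `t ∈ S ⊂ [−2T,2T]`, `[M₁,M₂] ⊂ [1,N]`, `N ≤ T` and a twist `z` with `Re z ≥ 0`,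
`Σ_t |Σ_m a_m m^{−½−it} m^{−z}|² ≤ 31·T(1 + log N)·Σ_m |a_m|²/m` (`sum_norm_sq_twistedPoly_le`) — the
tree's `Gallagher.discreteMeanValue` with coefficients `a_m m^{−½} m^{−z}`, `|m^{−z}| ≤ 1`; the point
being that the bound is UNIFORM in the twist (the Mellin variable `z = c + iu` of the separation).

## References
* [ConreyIwaniec2002] B. Conrey, H. Iwaniec, Acta Arith. 103 (2002) 259–312, §9 p. 20; Lemma 5.3.
* [Huxley1972] M. N. Huxley, *The Distribution of Prime Numbers*, Ch. 18 (18.29).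
-/

noncomputable section

open Complex MeasureTheory Real Filter

namespace Literature.NumberTheory.LFunctions

namespace HyperbolicSeparation

/-! ### Twisted Dirichlet polynomials: pointwise bounds and the discrete mean value -/

/-- `‖m^{−z}‖ ≤ 1` for `m ≥ 1` and `Re z ≥ 0` (private copy of a folklore one-liner also in
`LehmanCriticalLineNumerics`). [folklore] -/
private theorem norm_natCast_cpow_neg_le_one {m : ℕ} (hm : 1 ≤ m) {z : ℂ} (hz : 0 ≤ z.re) :
    ‖(m : ℂ) ^ (-z)‖ ≤ 1 := by
  rw [Complex.norm_natCast_cpow_of_pos (by omega), Complex.neg_re]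
  exact Real.rpow_le_one_of_one_le_of_nonpos (by exact_mod_cast hm) (by linarith)

/-- A twisted Dirichlet polynomial is bounded by the sum of its coefficients:
`‖Σ_m a_m m^{−s} m^{−z}‖ ≤ Σ_m ‖a_m‖` for `Re s, Re z ≥ 0`, `m ≥ 1`.
[cite: ConreyIwaniec2002, §9 p. 20 (separation of variables in mn > q⁴)] -/
theorem norm_twistedPoly_le (a : ℕ → ℂ) {M₁ M₂ : ℕ} (hM : 1 ≤ M₁) {s z : ℂ} (hs : 0 ≤ s.re)
    (hz : 0 ≤ z.re) :
    ‖∑ m ∈ Finset.Icc M₁ M₂, a m * (m : ℂ) ^ (-s) * (m : ℂ) ^ (-z)‖ ≤ ∑ m ∈ Finset.Icc M₁ M₂, ‖a m‖ := by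
  refine (norm_sum_le _ _).trans (Finset.sum_le_sum fun m hm => ?_)
  have hm1 : 1 ≤ m := hM.trans (Finset.mem_Icc.mp hm).1
  rw [norm_mul, norm_mul]
  have h1 := norm_natCast_cpow_neg_le_one hm1 hs
  have h2 := norm_natCast_cpow_neg_le_one hm1 hz
  calc ‖a m‖ * ‖(m : ℂ) ^ (-s)‖ * ‖(m : ℂ) ^ (-z)‖ ≤ ‖a m‖ * 1 * 1 := by
        gcongr
    _ = ‖a m‖ := by ring

/-- The twisted Dirichlet polynomial `u ↦ Σ_m a_m m^{−s} m^{−(c+iu)}` is continuous in `u`.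
[cite: ConreyIwaniec2002, §9 p. 20 (separation of variables in mn > q⁴)] -/
theorem continuous_twistedPoly (a : ℕ → ℂ) {M₁ M₂ : ℕ} (hM : 1 ≤ M₁) (s : ℂ) (c : ℝ) :
    Continuous fun u : ℝ =>
      ∑ m ∈ Finset.Icc M₁ M₂, a m * (m : ℂ) ^ (-s) * (m : ℂ) ^ (-((c : ℂ) + u * I)) := by
  refine continuous_finsetSum _ fun m hm => ?_
  have hm0 : (m : ℂ) ≠ 0 := by
    exact_mod_cast (show m ≠ 0 by have := (Finset.mem_Icc.mp hm).1; omega)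
  have hw : Continuous fun u : ℝ => -((c : ℂ) + u * I) := by fun_prop
  exact continuous_const.mul (hw.const_cpow (Or.inl hm0))

/-- **The discrete mean value theorem for a twisted Dirichlet polynomial** ("Lemma 5.3"): for
`1`-spaced `t ∈ S ⊂ [−2T, 2T]`, `[M₁,M₂] ⊂ [1,N]`, `N ≤ T`, and a twist `z` with `Re z ≥ 0`,
`Σ_t |Σ_m a_m m^{−½−it} m^{−z}|² ≤ 31·T(1 + log N)·Σ_m |a_m|²/m` — the tree's
`Gallagher.discreteMeanValue` with coefficients `a_m m^{−½} m^{−z}` (`|m^{−z}| ≤ 1`).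
[cite: ConreyIwaniec2002, Lemma 5.3; §9 p. 20] -/
theorem sum_norm_sq_twistedPoly_le (a : ℕ → ℂ) {N M₁ M₂ : ℕ} (hM : 1 ≤ M₁) (hMN : M₂ ≤ N)
    {T : ℝ} (hT : 0 < T) (hNT : (N : ℝ) ≤ T) (S : Finset ℝ) (hmem : ∀ t ∈ S, |t| ≤ 2 * T)
    (hsep : ∀ t ∈ S, ∀ t' ∈ S, t ≠ t' → (1 : ℝ) ≤ |t - t'|) {z : ℂ} (hz : 0 ≤ z.re) :
    ∑ t ∈ S, ‖∑ m ∈ Finset.Icc M₁ M₂, a m * (m : ℂ) ^ (-(1 / 2 + t * I)) * (m : ℂ) ^ (-z)‖ ^ 2 ≤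
      31 * T * (1 + Real.log N) * ∑ m ∈ Finset.Icc M₁ M₂, ‖a m‖ ^ 2 / m := by
  classical
  by_cases hMM : M₁ ≤ M₂
  swap
  · rw [Finset.Icc_eq_empty hMM]
    simp
  have hN1 : 1 ≤ N := hM.trans (hMM.trans hMN)
  have hT1 : 1 ≤ T := le_trans (by exact_mod_cast hN1) hNT
  -- the coefficients `A(m) = a(m) m^{-1/2} m^{-z}` on `[M₁, M₂]`, zero elsewhere
  set A : ℕ → ℂ := fun m =>
    if M₁ ≤ m ∧ m ≤ M₂ then a m * (m : ℂ) ^ (-(1 / 2 : ℂ)) * (m : ℂ) ^ (-z) else 0 with hA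
  have hsub : Finset.Icc M₁ M₂ ⊆ Finset.Icc 1 N := Finset.Icc_subset_Icc hM hMN
  -- the polynomial in Gallagher's form
  have hpoly : ∀ t : ℝ, ∑ m ∈ Finset.Icc M₁ M₂, a m * (m : ℂ) ^ (-(1 / 2 + t * I)) * (m : ℂ) ^ (-z) =
      ∑ m ∈ Finset.Icc 1 N, A m * (m : ℂ) ^ (-((t : ℂ) * I)) := by
    intro t
    rw [← Finset.sum_subset hsub (fun m _ hm => by
      rw [Finset.mem_Icc] at hm
      simp only [hA, if_neg hm, zero_mul])]
    refine Finset.sum_congr rfl fun m hm => ?_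
    have hm' := Finset.mem_Icc.mp hm
    have hm0 : (m : ℂ) ≠ 0 := by exact_mod_cast (show m ≠ 0 by omega)
    simp only [hA, hm', and_self, if_true]
    rw [neg_add, Complex.cpow_add _ _ hm0]
    ring
  simp_rw [hpoly]
  have hG := Gallagher.discreteMeanValue A N (by positivity : (0 : ℝ) < 2 * T) one_pos S hmem hsep
  -- the coefficient norms
  have hcoef : ∑ m ∈ Finset.Icc 1 N, ‖A m‖ ^ 2 ≤ ∑ m ∈ Finset.Icc M₁ M₂, ‖a m‖ ^ 2 / m := by
    rw [← Finset.sum_subset hsub (fun m _ hm => by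
      rw [Finset.mem_Icc] at hm
      simp only [hA, if_neg hm, norm_zero, sq, mul_zero])]
    refine Finset.sum_le_sum fun m hm => ?_
    have hm' := Finset.mem_Icc.mp hm
    have hm1 : 1 ≤ m := hM.trans hm'.1
    have hmpos : (0 : ℝ) < m := by exact_mod_cast hm1
    simp only [hA, hm', and_self, if_true, norm_mul]
    have hhalf : ‖(m : ℂ) ^ (-(1 / 2 : ℂ))‖ = (m : ℝ) ^ (-(1 / 2 : ℝ)) := by
      rw [show (-(1 / 2 : ℂ)) = ((-(1 / 2 : ℝ) : ℝ) : ℂ) by push_cast; ring,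
        Complex.norm_natCast_cpow_of_pos (by omega), Complex.ofReal_re]
    have hz1 : ‖(m : ℂ) ^ (-z)‖ ≤ 1 := norm_natCast_cpow_neg_le_one hm1 hz
    have hpow : ((m : ℝ) ^ (-(1 / 2 : ℝ))) ^ 2 = 1 / m := by
      rw [← Real.rpow_natCast, ← Real.rpow_mul hmpos.le]
      norm_num
      rw [Real.rpow_neg_one]
    rw [hhalf]
    calc (‖a m‖ * (m : ℝ) ^ (-(1 / 2 : ℝ)) * ‖(m : ℂ) ^ (-z)‖) ^ 2
        ≤ (‖a m‖ * (m : ℝ) ^ (-(1 / 2 : ℝ)) * 1) ^ 2 := by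
          gcongr
      _ = ‖a m‖ ^ 2 * (((m : ℝ) ^ (-(1 / 2 : ℝ))) ^ 2) := by ring
      _ = ‖a m‖ ^ 2 / m := by rw [hpow, ← div_eq_mul_one_div]
  -- the constant `(5(2T + 1/2) + 18N)(1 + log N) ≤ 31 T (1 + log N)`
  have hlogN : 0 ≤ Real.log N := Real.log_natCast_nonneg N
  have hK : (5 * (2 * T + 1 / 2) + 18 * (N : ℝ)) * ((1 : ℝ)⁻¹ + Real.log N) ≤
      31 * T * (1 + Real.log N) := by
    rw [inv_one]
    have : 5 * (2 * T + 1 / 2) + 18 * (N : ℝ) ≤ 31 * T := by linarith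
    exact mul_le_mul_of_nonneg_right this (by positivity)
  have hsum0 : 0 ≤ ∑ m ∈ Finset.Icc 1 N, ‖A m‖ ^ 2 := Finset.sum_nonneg fun _ _ => sq_nonneg _
  calc _ ≤ (5 * (2 * T + 1 / 2) + 18 * (N : ℝ)) * ((1 : ℝ)⁻¹ + Real.log N) *
        ∑ m ∈ Finset.Icc 1 N, ‖A m‖ ^ 2 := hG
    _ ≤ 31 * T * (1 + Real.log N) * ∑ m ∈ Finset.Icc M₁ M₂, ‖a m‖ ^ 2 / m :=
        mul_le_mul hK hcoef hsum0 (by positivity)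

/-- **Cauchy's inequality for products over the points.**
`Σ_t |P(t)Q(t)| ≤ (Σ_t|P(t)|²)^{1/2}(Σ_t|Q(t)|²)^{1/2}` (the step "by Cauchy's inequality" of p. 20).
[cite: ConreyIwaniec2002, §9 p. 20 (separation of variables in mn > q⁴)] -/
theorem sum_norm_mul_le_sqrt (S : Finset ℝ) (P Q : ℝ → ℂ) :
    ∑ t ∈ S, ‖P t * Q t‖ ≤
      Real.sqrt (∑ t ∈ S, ‖P t‖ ^ 2) * Real.sqrt (∑ t ∈ S, ‖Q t‖ ^ 2) := by
  have h := Finset.sum_mul_sq_le_sq_mul_sq S (fun t => ‖P t‖) (fun t => ‖Q t‖)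
  have h0 : 0 ≤ ∑ t ∈ S, ‖P t‖ * ‖Q t‖ := Finset.sum_nonneg fun _ _ => by positivity
  have hP : 0 ≤ ∑ t ∈ S, ‖P t‖ ^ 2 := Finset.sum_nonneg fun _ _ => sq_nonneg _
  simp_rw [norm_mul]
  calc ∑ t ∈ S, ‖P t‖ * ‖Q t‖ = Real.sqrt ((∑ t ∈ S, ‖P t‖ * ‖Q t‖) ^ 2) := (Real.sqrt_sq h0).symm
    _ ≤ Real.sqrt ((∑ t ∈ S, ‖P t‖ ^ 2) * ∑ t ∈ S, ‖Q t‖ ^ 2) := Real.sqrt_le_sqrt h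
    _ = _ := Real.sqrt_mul hP _

end HyperbolicSeparation

end Literature.NumberTheory.LFunctions

end
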